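import Summits.ResolutionOfSingularities.ResolutionOfSingularities.Theorems.EquisingularLiftEquisingularLiftNatFirstOrderPointsMatrix
import Summits.ResolutionOfSingularities.ResolutionOfSingularities.Theorems.EquisingularLiftEquisingularLiftNatCubicSurfaceOrdinaryPoints
import Summits.ResolutionOfSingularities.ResolutionOfSingularities.Theorems.EquisingularLiftEquisingularLiftNatCubicSurfaceOrdinaryResidual
import HarnessLib

/-!
# [OURS] ★★★ CUBIC SURFACES WHOSE SINGULAR POINTS ARE FIRST-ORDER (A₁, A₂, characteristic-2 nodes, …): EL♮ IN EVERY CHARACTERISTIC; the residuals of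
# `EquisingularLiftNatThree` (stmt-…-20148) and `EquisingularLiftNat` (stmt-…-20038) RE-CUT BY NAME

[OURS · leafhand-res-equisingularlift-9 g0, 2026-08-31; cell `pub/decomp-res`; items stmt-…-20148 / -20038 (companion: -15660)] AI-produced, weaker than
expert review; NOT a statement of any manuscript; nothing here proves resolution of singularities in positive characteristic.  DEF-FREE; no `sorry`;
standard axioms; ZERO named hypotheses.

leafhand-8's ✓ `CubicNodes.elNatAt_of_cubic_ordinary` settles the cubic surfaces all of whose singular points are ORDINARY (non-singular tangent cone).  With
the first-order machinery of this hand (✓ `FirstOrderPoint.elNatAt_of_firstOrderPoints_matrix₂`) the hypothesis weakens to FIRST-ORDER points: at each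
singular vector `b` (`b_{c₀} = 1`) the translated chart is `Φ + (Ψ₁ + Ψ')`, `Φ ≠ 0` of degree `μ ≥ 1`, `Ψ₁` of degree `μ + 1`, `Ψ' ∈ (y)^{μ+2}`, and `Φ`,
`∇Φ`, `Ψ₁` have no common non-zero zero — i.e. ONE blow-up of the point leaves a strict transform that is non-singular along the exceptional curve.  For a
cubic surface this adds the `A₂` points (tangent cone two planes, the cubic term non-zero on their common line) and, in characteristic `2`, the nodes
`y₀y₁ + y₂² + …` (✓ `FirstOrderPoint.firstOrder_A₂` / `firstOrder_node`) to the `A₁` points: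

* ★★★ `CubicNodes.elNatAt_of_cubic_firstOrder` — `K = K̄` of characteristic `p`, `ι : H ↪ ℙ³_K` a closed immersion with `range ι = V₊(F)`, `F` a PRIME
  cubic form all of whose singular points are first-order: `ELNatAt p K 3 H ι` (submaximal-line cubics inside, via ✓ `SubmaxLine.elNatAt_of_linSubst_mem_pow`;
  otherwise `≤ 4` singular points in general position, ✓ `CubicNodes.exists_normalized_matrix_of_singular`);
* ★ `CubicNodes.equisingularLiftNatThree_of_forall_elnatO_off_submaxLine_cubicFirstOrder` — `Theses.EquisingularLift.EquisingularLiftNatThree` BY NAME from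
  `ELNatConclusionO` at the non-regular prime-form surfaces of degree `e ≥ 3` with no submaximal line which are EITHER of degree `≥ 4` OR cubic with a
  singular point that is NOT first-order (witness `b, c₀`);
* ★ `CubicNodes.equisingularLiftNat_of_forall_elnatO_off_submaxLinN_cubicFirstOrder` — the same re-cut of `Theses.EquisingularLift.EquisingularLiftNat`.

Honest reading: closes no registered stub.  For cubic surfaces the residual of EL♮(3) is now: normal cubic surfaces with a singular point that is NOT
first-order — tangent cone two planes with the cubic term vanishing on their line (`A_{≥3}`), or a double plane (`D_4, D_5, E_6`), every characteristic —
which need TOWERS of point blow-ups; degree `≥ 4` untouched; `n ≥ 4` untouched (⊇ summit).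
-/

set_option linter.dupNamespace false -- mandated namespace `Summit.<Summit>.<Problem>` of this single-conjunct summit

noncomputable section

open CategoryTheory CategoryTheory.Limits AlgebraicGeometry TopologicalSpace
open MvPolynomial
open Literature.AlgebraicGeometry.Resolution
open Literature.AlgebraicGeometry.Motives Literature.AlgebraicGeometry.Motives.SmoothHypersurface
open Literature.AlgebraicGeometry.Motives.ProjectiveSpace

namespace Summit.ResolutionOfSingularities.ResolutionOfSingularities.Cruxes.EquisingularLiftNat.Sections

namespace CubicNodes

variable {K : Type} [Field K]

/-- ★★★ **EL♮ FOR EVERY INTEGRAL CUBIC SURFACE WHOSE SINGULAR POINTS ARE FIRST-ORDER POINTS — every characteristic.**  `K = K̄` of characteristic `p`;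
`ι : H ↪ ℙ³_K` a closed immersion with `range ι = V₊(F)`, `F` a prime cubic form; (fo) at every singular vector `b` (`F(b) = 0`, `∇F(b) = 0`) normalised by
`b_{c₀} = 1`, the chart `F(x_{c₀} := 1)` translated to `b` is `Φ + (Ψ₁ + Ψ')` with `Φ ≠ 0` a form of degree `μ ≥ 1`, `Ψ₁` a form of degree `μ + 1`,
`Ψ' ∈ (y)^{μ+2}`, and `Φ(v) = ∇Φ(v) = Ψ₁(v) = 0` only for `v = 0`.  Then `Theorems.EquisingularLift.ELNatAt p K 3 H ι`.  (Submaximal-line cubics: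
✓ `SubmaxLine.elNatAt_of_linSubst_mem_pow`; otherwise ✓ `exists_normalized_matrix_of_singular` and ✓ `FirstOrderPoint.elNatAt_of_firstOrderPoints_matrix₂`.)
Covers the `A₁` and `A₂` cubic surfaces of every characteristic, including the characteristic-2 nodes. [cite: Hartshorne1977, I Ex. 5.8, II Example 7.1.1] -/
theorem elNatAt_of_cubic_firstOrder (p : ℕ) (hp : p.Prime) [CharP K p] [IsAlgClosed K]
    {H : Scheme.{0}} (ι : H ⟶ (projectiveSpace (1 + 1 + 1) K).left) [IsClosedImmersion ι]
    (F : MvPolynomial (Fin (1 + 1 + 1 + 1)) K) (hF : F.IsHomogeneous 3) (hprime : Prime F)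
    (hrange : letI := MvPolynomial.gradedAlgebra (σ := Fin (1 + 1 + 1 + 1)) (R := K)
      Set.range ι = {x : Proj (homogeneousSubmodule (Fin (1 + 1 + 1 + 1)) K) | F ∈ x.asHomogeneousIdeal})
    (hfo : ∀ (b : Fin (1 + 2 + 1) → K) (c₀ : Fin (1 + 2 + 1)), b c₀ = 1 → eval b F = 0 → (∀ j, eval b (pderiv j F) = 0) →
      ∃ (μ : ℕ) (Φ Ψ₁ Ψ' : MvPolynomial (Fin (1 + 2)) K), 1 ≤ μ ∧ Φ.IsHomogeneous μ ∧ Φ ≠ 0 ∧ Ψ₁.IsHomogeneous (μ + 1) ∧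
        Ψ' ∈ Ideal.span (Set.range (X : Fin (1 + 2) → MvPolynomial (Fin (1 + 2)) K)) ^ (μ + 2) ∧
        aeval (fun j : Fin (1 + 2) => (X j : MvPolynomial (Fin (1 + 2)) K) + C (b (c₀.succAbove j))) (ProjectiveSpace.dehomogenize K c₀ F) =
          Φ + (Ψ₁ + Ψ') ∧
        ∀ v : Fin (1 + 2) → K, aeval v Φ = 0 → (∀ i, aeval v (pderiv i Φ) = 0) → aeval v Ψ₁ = 0 → v = 0) :
    Theorems.EquisingularLift.ELNatAt p K (1 + 1 + 1) H ι := by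
  classical
  by_cases hsm : ∃ B : Matrix (Fin 4) (Fin 4) K, IsUnit B.det ∧ aeval B.toMvPolynomial F ∈ (Ideal.span {(X 2 : MvPolynomial (Fin 4) K), X 3}) ^ 2
  · obtain ⟨B, hB, hmem⟩ := hsm
    exact SubmaxLine.elNatAt_of_linSubst_mem_pow (d := 1) p hp (B⁻¹).toMvPolynomial B.toMvPolynomial
      (Matrix.toMvPolynomial_isHomogeneous _) (Matrix.toMvPolynomial_isHomogeneous _)
      (MultiOrd.aeval_toMvPolynomial_inv_toMvPolynomial B hB) (MultiOrd.aeval_toMvPolynomial_toMvPolynomial_inv B hB) ι F hprime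
      (Literature.AlgebraicGeometry.ProjectiveSpace.IsHomogeneous.aeval_toMvPolynomial B hF) hmem hrange
  · push Not at hsm
    obtain ⟨B, S, c₀, hB, hS, hB1, hsing, hcov⟩ := exists_normalized_matrix_of_singular hF hprime hsm
    exact FirstOrderPoint.elNatAt_of_firstOrderPoints_matrix₂ (m := 1) p hp ι F hF hprime hrange B hB S hS c₀ (fun c _ => hB1 c)
      (fun c hc => hfo (fun l => B l c) (c₀ c) (hB1 c) (hsing c hc).1 (hsing c hc).2) hcov

/-- ★ **`Theses.EquisingularLift.EquisingularLiftNatThree` (stmt-…-20148) RE-CUT BY NAME: off the submaximal-line surfaces AND off the cubic surfaces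
with only first-order singular points.**  `ELNatConclusionO` is needed only for the non-regular `H = V₊(F)`, `F` a prime form of degree `e ≥ 3` with no
line of multiplicity `e − 1` in any coordinates, which for `e = 3` moreover carries a singular vector `b` (`b_{c₀} = 1`) at which NO first-order datum exists
(for no `μ, Φ, Ψ₁, Ψ'` as above is the translated chart `Φ + (Ψ₁ + Ψ')`).  [OURS · lh9 · DEF-FREE · pure reduction] [cite: Hartshorne1977, I Ex. 5.8, I Ex. 5.12] -/
theorem equisingularLiftNatThree_of_forall_elnatO_off_submaxLine_cubicFirstOrder
    (h : ∀ p : ℕ, p.Prime → ∀ (k : Type) [Field k] [CharP k p] [IsAlgClosed k] (H : Scheme.{0})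
      (ι : H ⟶ (Literature.AlgebraicGeometry.Motives.projectiveSpace 3 k).left), IsClosedImmersion ι → IsIntegral H →
      (∀ y : (Literature.AlgebraicGeometry.Motives.projectiveSpace 3 k).left,
        ∃ U : (Literature.AlgebraicGeometry.Motives.projectiveSpace 3 k).left.affineOpens,
          y ∈ (U : (Literature.AlgebraicGeometry.Motives.projectiveSpace 3 k).left.Opens) ∧ (ι.ker.ideal U).IsPrincipal) →
      ¬ Scheme.IsRegular H → ∀ (e : ℕ) (F : MvPolynomial (Fin (3 + 1)) k), 3 ≤ e → F.IsHomogeneous e → Prime F →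
      (letI := MvPolynomial.gradedAlgebra (σ := Fin (3 + 1)) (R := k)
       Set.range ι = {x : Proj (homogeneousSubmodule (Fin (3 + 1)) k) | F ∈ x.asHomogeneousIdeal}) →
      (∀ (τ τ' : Fin (3 + 1) → MvPolynomial (Fin (3 + 1)) k) (d : ℕ) (A B C : MvPolynomial (Fin 2) k),
        (∀ i, (τ i).IsHomogeneous 1) → (∀ i, (τ' i).IsHomogeneous 1) → (∀ i, aeval τ (τ' i) = X i) → (∀ i, aeval τ' (τ i) = X i) →
        A.IsHomogeneous (d + 1) → B.IsHomogeneous (d + 1) → C.IsHomogeneous (d + 2) →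
        aeval τ' F ≠ X 0 * rename (![2, 3] : Fin 2 → Fin (3 + 1)) A + X 1 * rename (![2, 3] : Fin 2 → Fin (3 + 1)) B +
          rename (![2, 3] : Fin 2 → Fin (3 + 1)) C) →
      (e = 3 → ∃ (b : Fin (3 + 1) → k) (c₀ : Fin (3 + 1)), b c₀ = 1 ∧ eval b F = 0 ∧ (∀ j, eval b (pderiv j F) = 0) ∧
        ∀ (μ : ℕ) (Φ Ψ₁ Ψ' : MvPolynomial (Fin 3) k), 1 ≤ μ → Φ.IsHomogeneous μ → Φ ≠ 0 → Ψ₁.IsHomogeneous (μ + 1) →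
          Ψ' ∈ Ideal.span (Set.range (X : Fin 3 → MvPolynomial (Fin 3) k)) ^ (μ + 2) →
          (∀ v : Fin 3 → k, aeval v Φ = 0 → (∀ i, aeval v (pderiv i Φ) = 0) → aeval v Ψ₁ = 0 → v = 0) →
          aeval (fun j : Fin 3 => (X j : MvPolynomial (Fin 3) k) + C (b (c₀.succAbove j))) (ProjectiveSpace.dehomogenize k c₀ F) ≠ Φ + (Ψ₁ + Ψ')) →
      ELNatConclusionO k 3 H ι) :
    Summit.ResolutionOfSingularities.ResolutionOfSingularities.Theses.EquisingularLift.EquisingularLiftNatThree := by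
  refine SubmaxLine.equisingularLiftNatThree_of_forall_elnatO_off_submaxLine ?_
  intro p hp k _ _ _ H ι hι hH hloc hreg e F he hF hprime hrange hsubmax
  by_cases hgood : e = 3 ∧ ∀ (b : Fin (3 + 1) → k) (c₀ : Fin (3 + 1)), b c₀ = 1 → eval b F = 0 → (∀ j, eval b (pderiv j F) = 0) →
      ∃ (μ : ℕ) (Φ Ψ₁ Ψ' : MvPolynomial (Fin 3) k), 1 ≤ μ ∧ Φ.IsHomogeneous μ ∧ Φ ≠ 0 ∧ Ψ₁.IsHomogeneous (μ + 1) ∧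
        Ψ' ∈ Ideal.span (Set.range (X : Fin 3 → MvPolynomial (Fin 3) k)) ^ (μ + 2) ∧
        (∀ v : Fin 3 → k, aeval v Φ = 0 → (∀ i, aeval v (pderiv i Φ) = 0) → aeval v Ψ₁ = 0 → v = 0) ∧
        aeval (fun j : Fin 3 => (X j : MvPolynomial (Fin 3) k) + C (b (c₀.succAbove j))) (ProjectiveSpace.dehomogenize k c₀ F) = Φ + (Ψ₁ + Ψ')
  · obtain ⟨rfl, hall⟩ := hgood
    haveI := hι
    refine RouteCurrency.elnatO_of_elNatAt p hp k (1 + 1 + 1) H ι hι hH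
      (elNatAt_of_cubic_firstOrder (K := k) p hp ι F hF hprime hrange fun b c₀ hb1 hb0 hbd => ?_)
    obtain ⟨μ, Φ, Ψ₁, Ψ', h1, h2, h3, h4, h5, h6, h7⟩ := hall b c₀ hb1 hb0 hbd
    exact ⟨μ, Φ, Ψ₁, Ψ', h1, h2, h3, h4, h5, h7, h6⟩
  · refine h p hp k H ι hι hH hloc hreg e F he hF hprime hrange hsubmax fun he3 => ?_
    have hno : ¬ ∀ (b : Fin (3 + 1) → k) (c₀ : Fin (3 + 1)), b c₀ = 1 → eval b F = 0 → (∀ j, eval b (pderiv j F) = 0) →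
        ∃ (μ : ℕ) (Φ Ψ₁ Ψ' : MvPolynomial (Fin 3) k), 1 ≤ μ ∧ Φ.IsHomogeneous μ ∧ Φ ≠ 0 ∧ Ψ₁.IsHomogeneous (μ + 1) ∧
          Ψ' ∈ Ideal.span (Set.range (X : Fin 3 → MvPolynomial (Fin 3) k)) ^ (μ + 2) ∧
          (∀ v : Fin 3 → k, aeval v Φ = 0 → (∀ i, aeval v (pderiv i Φ) = 0) → aeval v Ψ₁ = 0 → v = 0) ∧
          aeval (fun j : Fin 3 => (X j : MvPolynomial (Fin 3) k) + C (b (c₀.succAbove j))) (ProjectiveSpace.dehomogenize k c₀ F) = Φ + (Ψ₁ + Ψ') :=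
      fun hall => hgood ⟨he3, hall⟩
    push Not at hno
    obtain ⟨b, c₀, hb1, hb0, hbd, hnone⟩ := hno
    exact ⟨b, c₀, hb1, hb0, hbd, fun μ Φ Ψ₁ Ψ' h1 h2 h3 h4 h5 h6 => hnone μ Φ Ψ₁ Ψ' h1 h2 h3 h4 h5 h6⟩

/-- ★ **`Theses.EquisingularLift.EquisingularLiftNat` (stmt-…-20038) RE-CUT BY NAME: off the submaximal codimension-2 linear subspaces AND off the cubic
surfaces with only first-order singular points** (every characteristic). [OURS · lh9 · DEF-FREE · pure reduction] [cite: Hartshorne1977, I Ex. 5.8, I Ex. 5.12] -/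
theorem equisingularLiftNat_of_forall_elnatO_off_submaxLinN_cubicFirstOrder
    (h : ∀ p : ℕ, p.Prime → ∀ (k : Type) [Field k] [CharP k p] [IsAlgClosed k] (n : ℕ) (H : Scheme.{0})
      (ι : H ⟶ (Literature.AlgebraicGeometry.Motives.projectiveSpace n k).left), IsClosedImmersion ι → IsIntegral H →
      (∀ y : (Literature.AlgebraicGeometry.Motives.projectiveSpace n k).left,
        ∃ U : (Literature.AlgebraicGeometry.Motives.projectiveSpace n k).left.affineOpens,
          y ∈ (U : (Literature.AlgebraicGeometry.Motives.projectiveSpace n k).left.Opens) ∧ (ι.ker.ideal U).IsPrincipal) →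
      3 ≤ n → ¬ Scheme.IsRegular H → ∀ (e : ℕ) (F : MvPolynomial (Fin (n + 1)) k), 3 ≤ e → F.IsHomogeneous e → Prime F →
      (letI := MvPolynomial.gradedAlgebra (σ := Fin (n + 1)) (R := k)
       Set.range ι = {x : Proj (homogeneousSubmodule (Fin (n + 1)) k) | F ∈ x.asHomogeneousIdeal}) →
      (∀ (τ τ' : Fin (n + 1) → MvPolynomial (Fin (n + 1)) k) (d : ℕ),
        (∀ i, (τ i).IsHomogeneous 1) → (∀ i, (τ' i).IsHomogeneous 1) → (∀ i, aeval τ (τ' i) = X i) → (∀ i, aeval τ' (τ i) = X i) →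
        (aeval τ' F).IsHomogeneous (d + 2) →
        aeval τ' F ∉ (Ideal.span {(X ⟨n - 1, by omega⟩ : MvPolynomial (Fin (n + 1)) k), X ⟨n, by omega⟩}) ^ (d + 1)) →
      (∀ hn : n = 3, e = 3 → ∃ (b : Fin (n + 1) → k) (c₀ : Fin (n + 1)), b c₀ = 1 ∧ eval b F = 0 ∧ (∀ j, eval b (pderiv j F) = 0) ∧
        ∀ (μ : ℕ) (Φ Ψ₁ Ψ' : MvPolynomial (Fin n) k), 1 ≤ μ → Φ.IsHomogeneous μ → Φ ≠ 0 → Ψ₁.IsHomogeneous (μ + 1) →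
          Ψ' ∈ Ideal.span (Set.range (X : Fin n → MvPolynomial (Fin n) k)) ^ (μ + 2) →
          (∀ v : Fin n → k, aeval v Φ = 0 → (∀ i, aeval v (pderiv i Φ) = 0) → aeval v Ψ₁ = 0 → v = 0) →
          aeval (fun j : Fin n => (X j : MvPolynomial (Fin n) k) + C (b (c₀.succAbove j))) (ProjectiveSpace.dehomogenize k c₀ F) ≠ Φ + (Ψ₁ + Ψ')) →
      ELNatConclusionO k n H ι) :
    Summit.ResolutionOfSingularities.ResolutionOfSingularities.Theses.EquisingularLift.EquisingularLiftNat := by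
  refine SubmaxLinN.equisingularLiftNat_of_forall_elnatO_off_submaxLinN ?_
  intro p hp k _ _ _ n H ι hι hH hloc hn hreg e F he hF hprime hrange hsubmax
  by_cases hgood : ∃ (hn : n = 3), e = 3 ∧ ∀ (b : Fin (n + 1) → k) (c₀ : Fin (n + 1)), b c₀ = 1 → eval b F = 0 →
      (∀ j, eval b (pderiv j F) = 0) →
      ∃ (μ : ℕ) (Φ Ψ₁ Ψ' : MvPolynomial (Fin n) k), 1 ≤ μ ∧ Φ.IsHomogeneous μ ∧ Φ ≠ 0 ∧ Ψ₁.IsHomogeneous (μ + 1) ∧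
        Ψ' ∈ Ideal.span (Set.range (X : Fin n → MvPolynomial (Fin n) k)) ^ (μ + 2) ∧
        (∀ v : Fin n → k, aeval v Φ = 0 → (∀ i, aeval v (pderiv i Φ) = 0) → aeval v Ψ₁ = 0 → v = 0) ∧
        aeval (fun j : Fin n => (X j : MvPolynomial (Fin n) k) + C (b (c₀.succAbove j))) (ProjectiveSpace.dehomogenize k c₀ F) = Φ + (Ψ₁ + Ψ')
  · obtain ⟨rfl, rfl, hall⟩ := hgood
    haveI := hι
    refine RouteCurrency.elnatO_of_elNatAt p hp k (1 + 1 + 1) H ι hι hH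
      (elNatAt_of_cubic_firstOrder (K := k) p hp ι F hF hprime hrange fun b c₀ hb1 hb0 hbd => ?_)
    obtain ⟨μ, Φ, Ψ₁, Ψ', h1, h2, h3, h4, h5, h6, h7⟩ := hall b c₀ hb1 hb0 hbd
    exact ⟨μ, Φ, Ψ₁, Ψ', h1, h2, h3, h4, h5, h7, h6⟩
  · refine h p hp k n H ι hι hH hloc hn hreg e F he hF hprime hrange hsubmax fun hn3 he3 => ?_
    have hno : ¬ ∀ (b : Fin (n + 1) → k) (c₀ : Fin (n + 1)), b c₀ = 1 → eval b F = 0 → (∀ j, eval b (pderiv j F) = 0) →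
        ∃ (μ : ℕ) (Φ Ψ₁ Ψ' : MvPolynomial (Fin n) k), 1 ≤ μ ∧ Φ.IsHomogeneous μ ∧ Φ ≠ 0 ∧ Ψ₁.IsHomogeneous (μ + 1) ∧
          Ψ' ∈ Ideal.span (Set.range (X : Fin n → MvPolynomial (Fin n) k)) ^ (μ + 2) ∧
          (∀ v : Fin n → k, aeval v Φ = 0 → (∀ i, aeval v (pderiv i Φ) = 0) → aeval v Ψ₁ = 0 → v = 0) ∧
          aeval (fun j : Fin n => (X j : MvPolynomial (Fin n) k) + C (b (c₀.succAbove j))) (ProjectiveSpace.dehomogenize k c₀ F) = Φ + (Ψ₁ + Ψ') :=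
      fun hall => hgood ⟨hn3, he3, hall⟩
    push Not at hno
    obtain ⟨b, c₀, hb1, hb0, hbd, hnone⟩ := hno
    exact ⟨b, c₀, hb1, hb0, hbd, fun μ Φ Ψ₁ Ψ' h1 h2 h3 h4 h5 h6 => hnone μ Φ Ψ₁ Ψ' h1 h2 h3 h4 h5 h6⟩

end CubicNodes

end Summit.ResolutionOfSingularities.ResolutionOfSingularities.Cruxes.EquisingularLiftNat.Sections

end
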